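import Mathlib
import Summits.ValiantsHypothesis.ValiantsHypothesis.Theses.FermionizationDimension
import Summits.ValiantsHypothesis.ValiantsHypothesis.Theorems.DetqpThesis.Negative.NotQPBoundedOfExp

/-!
# Crux `ClassTransfer` (stmt-ValiantsHypothesis-7287), line `registered` (birth):
# the sign character is NOT in the cheap cone below level `n/2 - 2`, and what that does to
# the structural stub `stub_coneExhaustsVP`

The line `Lines/birth.lean` cuts the crux at the CHEAP CONE of level `D` on `S_n`: the span of
the indicator functions `σ ↦ [c₁(σ) = k ∧ σ|_S = τ|_S]` (`k ≤ n`, `|S| ≤ D`, `τ ∈ S_n`, `c₁` =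
number of fixed points), written out as the explicit finite expansion
`Σ_{k ≤ n} Σ_{|S| ≤ D} Σ_τ [c₁(σ) = k ∧ ∀ i ∈ S, σ i = τ i] · a k S τ` with a coefficient table `a`.
Its structural stub `stub_coneExhaustsVP` asserts that for every CLASS-FUNCTION family `χ` whose
generalized-matrix-function family is in `VP`, `sgn · χ_n` lies in the cone of level
`(log₂ n + c)^c` for every `n`.

This file records two kernel-checked facts about that cut (lead prover of the line, supports
stmt-ValiantsHypothesis-7287):

* `sign_not_mem_cheapCone` — **the sign character of `S_n` is not in the cheap cone of level `D`
  as soon as `2 D + 4 ≤ n`.**  Proof (antisymmetrisation): put `m = D + 2`, let `Y ⊆ Fin n` be the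
  first `m` points and `σ₀` a block swap moving `Y` off itself (`σ₀(Y) ∩ Y = ∅`).  For
  `π ∈ Sym(Y)` the permutations `σ₀ π` all have the same fixed points as `σ₀`, and for a generator
  with `|S| ≤ D` two points `y₁ ≠ y₂` of `Y` lie outside `S`, so `π ↦ π · (y₁ y₂)` is a
  sign-reversing involution preserving `[c₁(σ₀π) = k ∧ σ₀π|_S = τ|_S]`; hence
  `Σ_π sgn(π) · generator(σ₀ π) = 0` for every generator, while `Σ_π sgn(π) sgn(σ₀ π) = m! · sgn σ₀
  ≠ 0`.
* `valiantsHypothesis_of_coneExhaustsVP` — consequently **the structural stub alone implies the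
  summit**: applied to `χ ≡ 1` (whose GMF family is the permanent family) it would put `sgn_n` in
  the cone of level `(log₂ n + c)^c < n/2 - 2` for large `n`, so `per ∉ VP`, so `VP ≠ VNP`
  (`not_isVPFamily_perGMF_of_coneExhaustsVP`, then the bundling bridge exactly as in the route's
  deciding theorem).  In particular the line's other stub (`stub_cheapConeRealisable`) and the
  route's other crux (`SDimPerNotQP`) are not needed once `stub_coneExhaustsVP` is known: the stub
  is summit-hard, which is the lead's calibration of the line (crux workfiles
  `Cruxes/ClassTransfer/PICKED.md`).

No new definitions; the cone expansion is written inline exactly as in the registered stub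
signatures.  References: the cone and both stubs — `Cruxes/ClassTransfer/Lines/birth.lean`;
antisymmetrisation over a Young subgroup is folklore (James–Kerber §2); the bridge
`VP = VNP ⇒ per ∈ VP` is the tree's `perFamily_mem_VNP_holds` / `mem_VP_ofFintype_iff_holds`
[Burgisser2000, Def. 2.4–2.5, Thm. 2.10].
-/

set_option linter.dupNamespace false

noncomputable section

namespace Summit.ValiantsHypothesis.ValiantsHypothesis.Theorems.ClassTransfer.Negative

open Equiv Finset

/-! ## Block bookkeeping on `Fin n` -/

/-- A block swap: for `m + m ≤ n` there is a permutation of `Fin n` moving every point of the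
first block `[0, m)` to a point `≥ m` (namely `x ↦ x + m` there, `x ↦ x - m` on the second block,
identity above `2m`). [folklore] -/
theorem exists_blockSwap {n m : ℕ} (hm : m + m ≤ n) :
    ∃ σ₀ : Perm (Fin n), ∀ x : Fin n, (x : ℕ) < m → m ≤ ((σ₀ x : Fin n) : ℕ) := by
  let g : Fin n → Fin n := fun x =>
    if h₁ : (x : ℕ) < m then ⟨(x : ℕ) + m, by omega⟩
    else if h₂ : (x : ℕ) < m + m then ⟨(x : ℕ) - m, by omega⟩ else x
  have hg_val : ∀ x : Fin n, ((g x : Fin n) : ℕ) =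
      if (x : ℕ) < m then (x : ℕ) + m else if (x : ℕ) < m + m then (x : ℕ) - m else (x : ℕ) := by
    intro x
    dsimp only [g]
    split_ifs <;> rfl
  have hg : Function.Involutive g := by
    intro x
    apply Fin.ext
    rw [hg_val, hg_val]
    split_ifs <;> omega
  refine ⟨hg.toPerm g, fun x hx => ?_⟩
  show m ≤ ((g x : Fin n) : ℕ)
  rw [hg_val, if_pos hx]
  omega

/-- Extension of a permutation of `Fin m` to the first block of `Fin n`: on the block it stays in
the block. [folklore] -/
theorem extendDomain_block_apply_lt {n m : ℕ} (hmn : m ≤ n) (ρ : Perm (Fin m)) (x : Fin n)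
    (hx : (x : ℕ) < m) :
    ((ρ.extendDomain (Fin.castLEOrderIso hmn).toEquiv x : Fin n) : ℕ) < m := by
  rw [Perm.extendDomain_apply_subtype (p := fun i : Fin n => (i : ℕ) < m) ρ _ hx]
  exact ((Fin.castLEOrderIso hmn).toEquiv _).prop

/-- Extension of a permutation of `Fin m` to the first block of `Fin n`: identity off the block.
[folklore] -/
theorem extendDomain_block_apply_not_lt {n m : ℕ} (hmn : m ≤ n) (ρ : Perm (Fin m)) (x : Fin n)
    (hx : ¬ (x : ℕ) < m) :
    ρ.extendDomain (Fin.castLEOrderIso hmn).toEquiv x = x :=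
  Perm.extendDomain_apply_not_subtype (p := fun i : Fin n => (i : ℕ) < m) ρ _ hx

/-- Composed with a block swap `σ₀`, the fixed-point set of `σ₀ · ext ρ` does not depend on the
permutation `ρ` of the block (no point of the block is ever fixed). [folklore] -/
theorem filter_fixed_blockSwap_mul_extendDomain {n m : ℕ} (hmn : m ≤ n) (σ₀ : Perm (Fin n))
    (hσ₀ : ∀ x : Fin n, (x : ℕ) < m → m ≤ ((σ₀ x : Fin n) : ℕ)) (ρ : Perm (Fin m)) :
    (univ.filter fun i : Fin n =>
        (σ₀ * ρ.extendDomain (Fin.castLEOrderIso hmn).toEquiv) i = i) =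
      univ.filter fun i : Fin n => σ₀ i = i := by
  refine Finset.filter_congr fun x _ => ?_
  rw [Perm.mul_apply]
  by_cases hx : (x : ℕ) < m
  · have h1 := hσ₀ _ (extendDomain_block_apply_lt hmn ρ x hx)
    have h2 := hσ₀ x hx
    constructor
    · intro h
      exfalso
      have h' : ((σ₀ (ρ.extendDomain (Fin.castLEOrderIso hmn).toEquiv x) : Fin n) : ℕ) =
          (x : ℕ) := by rw [h]
      omega
    · intro h
      exfalso
      have h' : ((σ₀ x : Fin n) : ℕ) = (x : ℕ) := by rw [h]
      omega
  · rw [extendDomain_block_apply_not_lt hmn ρ x hx]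

/-- Outside a small set `S` (`|S| + 2 ≤ m`) the block `[0, m)` still has two distinct points.
[folklore] -/
theorem exists_two_block_points_not_mem {n m : ℕ} (hmn : m ≤ n) (S : Finset (Fin n))
    (hS : S.card + 2 ≤ m) :
    ∃ y₁ y₂ : Fin m, y₁ ≠ y₂ ∧
      (((Fin.castLEOrderIso hmn).toEquiv y₁ : Fin n) ∉ S) ∧
      (((Fin.castLEOrderIso hmn).toEquiv y₂ : Fin n) ∉ S) := by
  set f := (Fin.castLEOrderIso hmn).toEquiv with hf
  have hTle : (univ.filter fun y : Fin m => ((f y : Fin n)) ∈ S).card ≤ S.card := by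
    refine Finset.card_le_card_of_injOn (fun y => ((f y : Fin n))) (fun y hy => ?_) ?_
    · exact Finset.mem_coe.2 (Finset.mem_filter.1 (Finset.mem_coe.1 hy)).2
    · intro y₁ _ y₂ _ h
      exact f.injective (Subtype.ext h)
  have hsplit := Finset.card_filter_add_card_filter_not
    (s := (univ : Finset (Fin m))) (fun y => ((f y : Fin n)) ∈ S)
  rw [Finset.card_univ, Fintype.card_fin] at hsplit
  have hlt : 1 < (univ.filter fun y : Fin m => ¬ ((f y : Fin n)) ∈ S).card := by omega
  obtain ⟨y₁, hy₁, y₂, hy₂, hne⟩ := Finset.one_lt_card.1 hlt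
  exact ⟨y₁, y₂, hne, (Finset.mem_filter.1 hy₁).2, (Finset.mem_filter.1 hy₂).2⟩

/-! ## The sign character is not in the cheap cone of level `D` once `2D + 4 ≤ n` -/

/-- **Antisymmetrisation kills every cone generator.** With `σ₀` a block swap of the first
`m` points and `|S| + 2 ≤ m`, the signed sum over the block's symmetric group of the generator
`[c₁(σ₀π) = k ∧ σ₀π|_S = τ|_S] · c` vanishes (sign-reversing involution `π ↦ π · (y₁ y₂)` with
`y₁, y₂` block points outside `S`). [folklore] -/
theorem sum_sign_mul_generator_eq_zero {n m : ℕ} (hmn : m ≤ n) (σ₀ : Perm (Fin n))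
    (hσ₀ : ∀ x : Fin n, (x : ℕ) < m → m ≤ ((σ₀ x : Fin n) : ℕ))
    (k : ℕ) (S : Finset (Fin n)) (hS : S.card + 2 ≤ m) (τ : Perm (Fin n)) (c : ℂ) :
    ∑ π : Perm (Fin m), ((Perm.sign π : ℤ) : ℂ) *
      (if (univ.filter fun i : Fin n =>
              (σ₀ * π.extendDomain (Fin.castLEOrderIso hmn).toEquiv) i = i).card = k ∧
            (∀ i ∈ S, (σ₀ * π.extendDomain (Fin.castLEOrderIso hmn).toEquiv) i = τ i)
        then c else 0) = 0 := by
  set f := (Fin.castLEOrderIso hmn).toEquiv with hf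
  obtain ⟨y₁, y₂, hne, hy₁, hy₂⟩ := exists_two_block_points_not_mem hmn S hS
  set s : Perm (Fin m) := swap y₁ y₂ with hs
  -- `ext s` fixes every point of `S`
  have hfixS : ∀ i ∈ S, (s.extendDomain f) i = i := by
    intro i hi
    by_cases hi' : (i : ℕ) < m
    · rw [hf, Perm.extendDomain_apply_subtype (p := fun j : Fin n => (j : ℕ) < m) s _ hi']
      set y := (Fin.castLEOrderIso hmn).toEquiv.symm ⟨i, hi'⟩ with hy
      have hyi : ((Fin.castLEOrderIso hmn).toEquiv y : Fin n) = i := by simp [hy]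
      have h1 : y ≠ y₁ := by rintro rfl; exact hy₁ (hyi ▸ hi)
      have h2 : y ≠ y₂ := by rintro rfl; exact hy₂ (hyi ▸ hi)
      rw [hs, swap_apply_of_ne_of_ne h1 h2]
      exact hyi
    · exact extendDomain_block_apply_not_lt hmn s i hi'
  -- the sign flips
  have hsign : ∀ π : Perm (Fin m),
      ((Perm.sign (π * s) : ℤ) : ℂ) = -((Perm.sign π : ℤ) : ℂ) := by
    intro π
    rw [Perm.sign_mul, hs, Perm.sign_swap hne]
    simp
  -- the generator is invariant
  have hval : ∀ π : Perm (Fin m),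
      (if (univ.filter fun i : Fin n => (σ₀ * (π * s).extendDomain f) i = i).card = k ∧
            (∀ i ∈ S, (σ₀ * (π * s).extendDomain f) i = τ i) then c else 0) =
      (if (univ.filter fun i : Fin n => (σ₀ * π.extendDomain f) i = i).card = k ∧
            (∀ i ∈ S, (σ₀ * π.extendDomain f) i = τ i) then c else 0) := by
    intro π
    rw [hf, filter_fixed_blockSwap_mul_extendDomain hmn σ₀ hσ₀ (π * s),
      filter_fixed_blockSwap_mul_extendDomain hmn σ₀ hσ₀ π]
    have hS' : (∀ i ∈ S, (σ₀ * (π * s).extendDomain f) i = τ i) ↔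
        (∀ i ∈ S, (σ₀ * π.extendDomain f) i = τ i) := by
      refine forall₂_congr fun i hi => ?_
      rw [← Perm.extendDomain_mul, ← mul_assoc, Perm.mul_apply (σ₀ * π.extendDomain f),
        hfixS i hi]
    exact if_congr (and_congr Iff.rfl hS') rfl rfl
  -- the summand and the involution
  set G : Perm (Fin m) → ℂ := fun π => ((Perm.sign π : ℤ) : ℂ) *
      (if (univ.filter fun i : Fin n => (σ₀ * π.extendDomain f) i = i).card = k ∧
            (∀ i ∈ S, (σ₀ * π.extendDomain f) i = τ i)
        then c else 0) with hG
  have hG' : ∀ π, G (π * s) = -G π := by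
    intro π
    simp only [hG]
    rw [hval π, hsign π, neg_mul]
  have hsum : ∑ π, G π = ∑ π, G (π * s) :=
    (Fintype.sum_equiv (Equiv.mulRight s) (fun π => G (π * s)) G (fun π => rfl)).symm
  have hsum' : ∑ π, G (π * s) = -∑ π, G π := by
    rw [← Finset.sum_neg_distrib]
    exact Finset.sum_congr rfl fun π _ => hG' π
  have h2 : (2 : ℂ) * ∑ π, G π = 0 := by
    rw [two_mul]
    nth_rw 2 [hsum]
    rw [hsum']
    ring
  simpa using h2

/-- **The sign character is not in the cheap cone of level `D` on `S_n` when `2D + 4 ≤ n`.**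
No coefficient table `a` expands `sgn` in the indicators `[c₁(σ) = k ∧ σ|_S = τ|_S]`,
`|S| ≤ D`.  (Antisymmetrise over the symmetric group of the first `D + 2` points after a block
swap: every generator dies by `sum_sign_mul_generator_eq_zero`, the sign character gives
`(D+2)! · sgn σ₀ ≠ 0`.) [folklore] -/
theorem sign_not_mem_cheapCone {n D : ℕ} (hn : 2 * D + 4 ≤ n)
    (a : ℕ → Finset (Fin n) → Perm (Fin n) → ℂ)
    (h : ∀ σ : Perm (Fin n), ((Perm.sign σ : ℤ) : ℂ) =
      ∑ k ∈ Finset.range (n + 1),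
        ∑ S ∈ (Finset.univ : Finset (Finset (Fin n))).filter (fun S => S.card ≤ D),
          ∑ τ : Perm (Fin n),
            if (Finset.univ.filter fun i : Fin n => σ i = i).card = k ∧ (∀ i ∈ S, σ i = τ i)
            then a k S τ else 0) : False := by
  set m := D + 2 with hm
  have hmm : m + m ≤ n := by omega
  have hmn : m ≤ n := by omega
  obtain ⟨σ₀, hσ₀⟩ := exists_blockSwap hmm
  set f := (Fin.castLEOrderIso hmn).toEquiv with hf
  -- left-hand side of the antisymmetrised identity: `m! · sgn σ₀`
  have lhs : ∑ π : Perm (Fin m), ((Perm.sign π : ℤ) : ℂ) *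
      ((Perm.sign (σ₀ * π.extendDomain f) : ℤ) : ℂ) =
      (Nat.factorial m : ℂ) * ((Perm.sign σ₀ : ℤ) : ℂ) := by
    have hterm : ∀ π : Perm (Fin m), ((Perm.sign π : ℤ) : ℂ) *
        ((Perm.sign (σ₀ * π.extendDomain f) : ℤ) : ℂ) = ((Perm.sign σ₀ : ℤ) : ℂ) := by
      intro π
      have hsq : ((Perm.sign π : ℤ) : ℂ) * ((Perm.sign π : ℤ) : ℂ) = 1 := by
        rw [← Int.cast_mul, ← Units.val_mul, Int.units_mul_self]
        simp
      rw [Perm.sign_mul, Perm.sign_extendDomain, Units.val_mul, Int.cast_mul]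
      calc ((Perm.sign π : ℤ) : ℂ) * (((Perm.sign σ₀ : ℤ) : ℂ) * ((Perm.sign π : ℤ) : ℂ))
          = ((Perm.sign σ₀ : ℤ) : ℂ) * (((Perm.sign π : ℤ) : ℂ) * ((Perm.sign π : ℤ) : ℂ)) := by
            ring
        _ = ((Perm.sign σ₀ : ℤ) : ℂ) := by rw [hsq, mul_one]
    rw [Finset.sum_congr rfl fun π _ => hterm π, Finset.sum_const, Finset.card_univ,
      Fintype.card_perm, Fintype.card_fin, nsmul_eq_mul]
  -- right-hand side: zero, generator by generator
  have rhs : (∑ π : Perm (Fin m), ((Perm.sign π : ℤ) : ℂ) *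
        ∑ k ∈ Finset.range (n + 1),
          ∑ S ∈ (Finset.univ : Finset (Finset (Fin n))).filter (fun S => S.card ≤ D),
            ∑ τ : Perm (Fin n),
              if (Finset.univ.filter fun i : Fin n => (σ₀ * π.extendDomain f) i = i).card = k ∧
                  (∀ i ∈ S, (σ₀ * π.extendDomain f) i = τ i)
              then a k S τ else 0) = 0 := by
    simp_rw [Finset.mul_sum]
    rw [Finset.sum_comm]
    refine Finset.sum_eq_zero fun k _ => ?_
    rw [Finset.sum_comm]
    refine Finset.sum_eq_zero fun S hS => ?_
    rw [Finset.sum_comm]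
    refine Finset.sum_eq_zero fun τ _ => ?_
    have hS' : S.card + 2 ≤ m := by
      have := (Finset.mem_filter.1 hS).2
      omega
    exact sum_sign_mul_generator_eq_zero hmn σ₀ hσ₀ k S hS' τ (a k S τ)
  -- compare
  have key : ∑ π : Perm (Fin m), ((Perm.sign π : ℤ) : ℂ) *
      ((Perm.sign (σ₀ * π.extendDomain f) : ℤ) : ℂ) = 0 := by
    rw [← rhs]
    exact Finset.sum_congr rfl fun π _ => by rw [h (σ₀ * π.extendDomain f)]
  rw [lhs] at key
  have hfact : (Nat.factorial m : ℂ) ≠ 0 := Nat.cast_ne_zero.2 (Nat.factorial_ne_zero m)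
  have hsign : ((Perm.sign σ₀ : ℤ) : ℂ) ≠ 0 := by
    rcases Int.units_eq_one_or (Perm.sign σ₀) with h1 | h1 <;> simp [h1]
  exact mul_ne_zero hfact hsign key

/-! ## The structural stub implies the summit -/

/-- Arithmetic: the polylogarithmic level `(log₂ n + c)^c` drops below `n/2 - 2` somewhere
(indeed for all large `n`). [folklore] -/
theorem exists_two_mul_level_add_four_le (c : ℕ) :
    ∃ n : ℕ, 2 * (Nat.log 2 n + c) ^ c + 4 ≤ n := by
  obtain ⟨n, hn16, -, hle⟩ :=
    Summit.ValiantsHypothesis.Theorems.DetqpThesis.Negative.exists_ge_qpExp_le (c + 1) 16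
  refine ⟨n, ?_⟩
  have hlog : 4 ≤ Nat.log 2 n := by
    have h16 : Nat.log 2 16 = 4 := by
      have := Nat.log_pow (b := 2) Nat.one_lt_two 4
      simpa using this
    rw [← h16]
    exact Nat.log_mono_right hn16
  set A := Nat.log 2 n + c with hA
  have hA1 : Nat.log 2 n + (c + 1) = A + 1 := by omega
  rw [hA1, pow_succ] at hle
  have h5 : A ^ c * 5 ≤ (A + 1) ^ c * (A + 1) :=
    Nat.mul_le_mul (Nat.pow_le_pow_left (Nat.le_succ A) c) (by omega)
  omega

/-- **`stub_coneExhaustsVP` puts the permanent outside `VP`.**  The hypothesis is the registered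
signature of the structural stub of line `birth` verbatim; at `χ ≡ 1` it would expand `sgn_n` in
the cheap cone of level `(log₂ n + c)^c`, impossible once `2 (log₂ n + c)^c + 4 ≤ n`
(`sign_not_mem_cheapCone`). [folklore] -/
theorem not_isVPFamily_perGMF_of_coneExhaustsVP
    (H : ∀ χ : (n : ℕ) → Equiv.Perm (Fin n) → ℂ,
      (∀ n (σ τ : Equiv.Perm (Fin n)), IsConj σ τ → χ n σ = χ n τ) →
      Literature.Computability.AlgebraicComplexity.IsVPFamily
        (fun n => ∑ σ : Equiv.Perm (Fin n),
          MvPolynomial.C (χ n σ) * ∏ i : Fin n, MvPolynomial.X (σ i, i)) →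
      ∃ c : ℕ, ∀ n : ℕ, ∃ a : ℕ → Finset (Fin n) → Equiv.Perm (Fin n) → ℂ,
        ∀ σ : Equiv.Perm (Fin n), ((Equiv.Perm.sign σ : ℤ) : ℂ) * χ n σ =
          ∑ k ∈ Finset.range (n + 1),
            ∑ S ∈ (Finset.univ : Finset (Finset (Fin n))).filter
                (fun S => S.card ≤ (Nat.log 2 n + c) ^ c),
              ∑ τ : Equiv.Perm (Fin n),
                if (Finset.univ.filter fun i : Fin n => σ i = i).card = k ∧ (∀ i ∈ S, σ i = τ i)
                then a k S τ else 0) :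
    ¬ Literature.Computability.AlgebraicComplexity.IsVPFamily
        (fun n => ∑ σ : Equiv.Perm (Fin n),
          MvPolynomial.C ((fun (m : ℕ) (_ : Equiv.Perm (Fin m)) => (1 : ℂ)) n σ) *
            ∏ i : Fin n, MvPolynomial.X (σ i, i)) := by
  intro hVP
  obtain ⟨c, hc⟩ := H (fun (m : ℕ) (_ : Equiv.Perm (Fin m)) => (1 : ℂ)) (fun _ _ _ _ => rfl) hVP
  obtain ⟨n, hn⟩ := exists_two_mul_level_add_four_le c
  obtain ⟨a, ha⟩ := hc n
  exact sign_not_mem_cheapCone hn a fun σ => (mul_one _).symm.trans (ha σ)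

/-- **The structural stub of line `birth` implies Valiant's hypothesis by itself.**
`VP = VNP` would put the permanent family in `VP` (`perFamily_mem_VNP_holds`,
`mem_VP_ofFintype_iff_holds`), and the permanent family is the generalized-matrix-function family
of the class function `χ ≡ 1`, excluded by `not_isVPFamily_perGMF_of_coneExhaustsVP`.  So the
stub is summit-hard: neither the algebraic stub `stub_cheapConeRealisable` nor the route's other
crux `SDimPerNotQP` is needed downstream of it. [folklore] -/
theorem valiantsHypothesis_of_coneExhaustsVP
    (H : ∀ χ : (n : ℕ) → Equiv.Perm (Fin n) → ℂ,
      (∀ n (σ τ : Equiv.Perm (Fin n)), IsConj σ τ → χ n σ = χ n τ) →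
      Literature.Computability.AlgebraicComplexity.IsVPFamily
        (fun n => ∑ σ : Equiv.Perm (Fin n),
          MvPolynomial.C (χ n σ) * ∏ i : Fin n, MvPolynomial.X (σ i, i)) →
      ∃ c : ℕ, ∀ n : ℕ, ∃ a : ℕ → Finset (Fin n) → Equiv.Perm (Fin n) → ℂ,
        ∀ σ : Equiv.Perm (Fin n), ((Equiv.Perm.sign σ : ℤ) : ℂ) * χ n σ =
          ∑ k ∈ Finset.range (n + 1),
            ∑ S ∈ (Finset.univ : Finset (Finset (Fin n))).filter
                (fun S => S.card ≤ (Nat.log 2 n + c) ^ c),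
              ∑ τ : Equiv.Perm (Fin n),
                if (Finset.univ.filter fun i : Fin n => σ i = i).card = k ∧ (∀ i ∈ S, σ i = τ i)
                then a k S τ else 0) :
    _root_.ValiantsHypothesis := by
  show Literature.Computability.AlgebraicComplexity.VP ℂ ≠
    Literature.Computability.AlgebraicComplexity.VNP ℂ
  intro hEq
  have hVNP := Literature.Computability.AlgebraicComplexity.perFamily_mem_VNP_holds ℂ
  have hVP : Literature.Computability.AlgebraicComplexity.perFamily ℂ ∈
      Literature.Computability.AlgebraicComplexity.VP ℂ := by rw [hEq]; exact hVNP
  have hper : Literature.Computability.AlgebraicComplexity.IsVPFamily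
      (fun n => Literature.Computability.AlgebraicComplexity.perPoly (Fin n) ℂ) :=
    (Literature.Computability.AlgebraicComplexity.mem_VP_ofFintype_iff_holds _).1 hVP
  have hfun : (fun n => ∑ σ : Equiv.Perm (Fin n),
      MvPolynomial.C ((fun (m : ℕ) (_ : Equiv.Perm (Fin m)) => (1 : ℂ)) n σ) *
        ∏ i : Fin n, MvPolynomial.X (σ i, i)) =
      (fun n => Literature.Computability.AlgebraicComplexity.perPoly (Fin n) ℂ) := by
    funext n
    simp [Literature.Computability.AlgebraicComplexity.perPoly, Matrix.permanent,
      Matrix.mvPolynomialX]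
  have hfam : Literature.Computability.AlgebraicComplexity.IsVPFamily
      (fun n => ∑ σ : Equiv.Perm (Fin n),
        MvPolynomial.C ((fun (m : ℕ) (_ : Equiv.Perm (Fin m)) => (1 : ℂ)) n σ) *
          ∏ i : Fin n, MvPolynomial.X (σ i, i)) := by
    rw [hfun]; exact hper
  exact not_isVPFamily_perGMF_of_coneExhaustsVP H hfam

end Summit.ValiantsHypothesis.ValiantsHypothesis.Theorems.ClassTransfer.Negative
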